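import Summits.QuantumFields.YangMills.Theorems.BalabanUVNodesN07NormalisationOfRecordWide
import Summits.QuantumFields.YangMills.Theorems.BalabanUVNodesN07NormalisationCrossingEnds
import Summits.QuantumFields.YangMills.Theorems.BalabanUVNodesN07SplitClauseBoxesCubeDomains
import Summits.QuantumFields.YangMills.Theorems.BalabanUVNodesN07ShearSizeTopBox
import HarnessLib

/-!
# N07 [B11] (= [15] = [Balaban1985Variational]) Sect. F — THE CHART's DATUM UNDER THE NORMALISATION OF RECORD ON PRINT's WINDOW `□̃` (`NrmOfRecordWide`, MODULE 60′):
# (154)₁ ON EVERY CONSTRAINT BOND OF `D″` (MODULE 61 re-keyed) AND THE TOP ROWS (160) WITH THE CENTRE-ROOTED TWO-SIDED BOUND `2·(d−1)·⌈□̃∕2⌉·δ̂` (MODULE 62 re-keyed to the root `ctr`)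

Cell `pub-ymgap`, seat `pub-ymgap-dag-n07-e` g25 (FAN-OUT §N07 row s3; LANE OWNER of the K0 road), MODULE 62″ = 61″ + 62″ (plan g90 RULING A3 (4): «then 60′; then queue (c) centre-root top
rows on □̃ from 74 RELEASED; 61″∕71″ re-keys; the ROW ADAPTER»).  `--kind proof --supports stmt-QuantumFields-20541 --as helper` (K0⁷); count-neutral; def-free.
CONSUMED BY NAME: MODULE 60′ (`NrmOfRecordWide`, `shearedAvgIter_landau_eq_iter_rep` via MODULE 60), MODULE 61 §3 (`gaugeAvgIter_bondIdx_ends_eq_one`, generic in the window), g24's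
`T4AxialGaugeRooted.dist1_gaugeAct_axialGaugeAt_le_uniform` (two-sided Poincaré), dag-n07-w4's `levelBoxes_of_Om_subset_cubeDomains`, dag-n07-w6's `mem_boxBonds_of_ends_mem_box`,
`B8Eq131Cubes.ctr_mem` (`|x − ctr|_∞ ≤ crad = ⌊S∕2⌋ + 2ρ` on `□̃`).  [15] = [Balaban1985Variational]; [3] = [Balaban1985Averaging]; [6] = [Balaban1985RegularSpaces]; [4] = [Balaban1984PropagatorsII].

WHY.  MODULES 61∕62 (p657543 ∕ p660006) read the chart's datum through MODULE 60's `NrmOfRecord`, whose top axial gauge is pv26's CORNER-rooted `axialGauge` on the chart box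
`[sqLo_j − 1, sqHi_j + 1]`; ruling A3 made MODULE 60′ `NrmOfRecordWide` — window print's `□̃ = [tLo, tHi] = [cornerP − 2ρ, cornerP + sideP − 1 + 2ρ]`, ROOT its CENTRE `ctr`
((147) «with a center at the point y») — the `Nrm` TEXT OF RECORD.  This file re-keys the two readers BY NAME: §2 ★★★ `NrmOfRecordWide.exists_rep_bondIdx` (61 §4 verbatim with the wide
top gauge: (154)₁ `𝒜_{j(c)}(U^u)(c) = M^{j(c)}((U^w)^{h̄})(c)` for EVERY `c : BondIdx D″`, ends supplied by 61 §3 under `Adm22 D″ R M_b`, `2L ≤ R·M_b + 1`); §3 ★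
`NrmOfRecordWide.shearedAvgIter_top_eq_dataAxial_of_lamBond` (top bonds: `𝒜_j(U^u)(c) = (V^{h})(c)`, `V = M^j U`, `h = axialGaugeAt V tLo tHi ctr`) and ★★★
`NrmOfRecordWide.norm_mlog_shearedAvgIter_top_le` — print's (160), first case, with the CENTRED radius: `‖log 𝒜_j(U^u)(c)‖ ≤ 2·((d−1)·crad·δ̂)`, `crad = ⌊sideP∕2⌋ + 2ρ` (62 had the
one-sided `(d−1)·n·δ̂`, `n` = the full chart-box width), from §1 ★ `dist1_gaugeAct_axialGaugeAt_le_of_mem_boxBonds` = g24's rooted two-sided Poincaré lemma read on `boxBonds` with the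
radius taken from `ctr_mem`; `Icc_chartBox_subset_Icc_printWindow` (chart box ⊆ `□̃`, labels).  The displayed letter is `δ̂ ≥ 0` = the plaquette smallness of `M^j U` on the `□̃` box («(7) for V» there — supplied from the token's data by MODULE 69b's
□̃-twin), plus the non-wrapping numerics `tHi ≤ tLo + n`, `n + 1 < N_j` and `(d−1)·crad·δ̂ ≤ ½`; `1 ≤ ρ` puts the chart box inside `□̃`.

HONEST SCOPE.  Count-neutral bookkeeping ∕ one elementary estimate; `NrmOfRecordWide` (its door CONDITIONAL on `HThm4Rec` by ruling A3), HS3NORM, HCHART-MEET-NORM, HBUDGET-NORM remain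
DISPLAYED hypotheses of the knit (MODULE 67c), discharged by nobody here; `Adm22` and `δ̂` are hypotheses; nothing of [15]∕[3]∕[6] ANALYSIS asserted; stub 1-G‴ ∕ K0⁷ ∕ K1⁹ NOT closed; N07 NOT
discharged and NOT claimable on road (β); counts unmoved (28∕28 · 7∕28); one finite 𝕋⁴ programme at fixed ε — the route closes the conditional finite-𝕋⁴ rung `BalabanLadder.UV` only; the YM
mass gap (Clay) is NOT proved by any of this; nothing continuum ∕ ℝ⁴ ∕ OS.  No `sorry`, no `def`, no `instance`, no `notation`.

References: [15] (144) p. 300, (147) p. 301, (150)–(154) pp. 301–302, (160) p. 303; [3] (21) p. 21, (78)–(81) p. 30, (88) p. 31; [6] p. 98, (1.129) p. 98, (1.131) p. 99; [4] (2.1)–(2.3) p. 224.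
-/

set_option autoImplicit false

noncomputable section

namespace Summit.QuantumFields.YangMills.BalabanUVNodes.N07NormalisationWideRows

open scoped Matrix.Norms.L2Operator
open Literature.MathematicalPhysics.QuantumFieldTheory.Balaban1983to89
open Literature.MathematicalPhysics.QuantumFieldTheory.Balaban1983to89.Node00
open T4Continuum (T4Family)
open T4AxialGaugeSmallField (castSite boxPlaqs boxBonds)
open T4AxialGaugeRooted (axialGaugeAt dist1_gaugeAct_axialGaugeAt_le_uniform)
open B12GaugeOrbits021 (IsResidual iter_gaugeAct_of_isResidual)
open B15Eq177GaugeInvariance (blockLift)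
open B14DomainGeom (Pt)
open B7Prop1Explicit (e)
open B8Eq131Cubes (sqLo sqHi tLo tHi ctr crad ctr_mem)
open B6SectADomainsV1 (Domains)
open B6SectAOperatorsV1 (BondIdx)
open GaugeField (gaugeAct)
open ExpMeanLog (expMeanLogSU)
open MatrixLog (mlog norm_mlog_le_two_mul)
open Summit.QuantumFields.Balaban3D.Carriers (radialContourData)
open Summit.QuantumFields.YangMills.Theorems.FlatCubeOpsText (Adm22)
open Summit.QuantumFields.YangMills.BalabanUVNodes.N07NormalisationOfRecord (shearedAvgIter_landau_eq_iter_rep)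
open Summit.QuantumFields.YangMills.BalabanUVNodes.N07NormalisationOfRecordWide (NrmOfRecordWide)
open Summit.QuantumFields.YangMills.BalabanUVNodes.N07NormalisationCrossingEnds (gaugeAvgIter_bondIdx_ends_eq_one)
open Summit.QuantumFields.YangMills.BalabanUVNodes.N09AxialSelectionExists (iter_gaugeAct_blockLift)
open Summit.QuantumFields.YangMills.BalabanUVNodes.N07ShearSizeTopBox (mem_boxBonds_of_ends_mem_box)
open Summit.QuantumFields.YangMills.BalabanUVNodes.N07SplitClauseBoxesCubeDomains (levelBoxes_of_Om_subset_cubeDomains)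

/-! ## §1  The rooted two-sided Poincaré bound on box bonds -/

section Rooted

variable {P : Params} {j : ℕ} {G : Type*} [GaugeGroup G]

/-- ★ **THE ROOTED TWO-SIDED BOUND ON A BOX BOND** (g24's `dist1_gaugeAct_axialGaugeAt_le_uniform` read on `boxBonds`): if the plaquettes based in `[lo, hi]` are `< δ`, the box does
not wrap, the root `r` lies in the box and every box point is within sup-distance `h` of `r`, then every box bond `b` has `dist1 ((U^{axialGaugeAt U lo hi r})(b)) ≤ (d−1)·h·δ`.
[cite: Balaban1985Variational, (147) p.301, (160) p.303; Balaban1985RegularSpaces, (1.129) p.98] -/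
theorem dist1_gaugeAct_axialGaugeAt_le_of_mem_boxBonds (U : GaugeField P j G) {lo hi : Fin P.d → ℤ} {δ : ℝ} {S₀ : Set (Plaq P j)} {h : ℕ}
    (hS₀ : boxPlaqs lo hi ⊆ S₀) (hU : PlaqSmallOn S₀ δ U) (hδ : 0 ≤ δ) (hN : ∀ κ, hi κ - lo κ < P.sitesPerDir j)
    {r : Fin P.d → ℤ} (hr : lo ≤ r) (hr' : r ≤ hi) (hrad : ∀ x : Fin P.d → ℤ, lo ≤ x → x ≤ hi → ∀ κ, |x κ - r κ| ≤ h)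
    {b : PBond P j} (hb : b ∈ boxBonds lo hi) :
    dist1 (gaugeAct (axialGaugeAt U lo hi r) U b) ≤ ((P.d - 1 : ℕ) : ℝ) * h * δ := by
  obtain ⟨x, hx, hxμ, hsrc⟩ := hb
  have hb' : b = ⟨castSite x, b.dir⟩ := by cases b; simp only at hsrc; rw [hsrc]
  have hxhi : x ≤ hi := fun κ => by
    have h1 := hxμ κ
    have h2 : (0 : ℤ) ≤ e b.dir κ := by
      simp only [B7Prop1Explicit.e_apply]; split_ifs <;> norm_num
    simp only [Pi.add_apply] at h1
    linarith
  rw [hb']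
  exact dist1_gaugeAct_axialGaugeAt_le_uniform U hS₀ hU hδ hN hr hr' hx hxμ (hrad x hx hxhi)

/-- On print's `□̃ = [tLo a ρ, tHi a S ρ]` every point is within sup-distance `crad S ρ = ⌊S∕2⌋ + 2ρ` of the centre `ctr a S` (`S ≥ 1`; `B8Eq131Cubes.ctr_mem`).
[cite: Balaban1985RegularSpaces, p.98 («y is a center of □̃^{(k)}»)] -/
theorem abs_sub_ctr_le_crad {d : ℕ} {a : Fin d → ℤ} {S ρ : ℕ} (hS : 1 ≤ S) (x : Fin d → ℤ) (hx : tLo a ρ ≤ x) (hx' : x ≤ tHi a S ρ) (κ : Fin d) :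
    |x κ - ctr a S κ| ≤ (crad S ρ : ℤ) := by
  obtain ⟨-, -, hr⟩ := ctr_mem (a := a) (ρ := ρ) hS
  have h1 := (hr κ).1
  have h2 := (hr κ).2
  have h3 := hx κ
  have h4 := hx' κ
  rw [abs_sub_le_iff]
  constructor <;> linarith

/-- The chart's top box `[sqLo_k − 1, sqHi_k + 1] = [c − ρ − 1, c + S − 1 + ρ + 1]` lies inside print's window `□̃ = [tLo c ρ, tHi c S ρ] = [c − 2ρ, c + S − 1 + 2ρ]` (`1 ≤ ρ`) — the label
form of MODULE 66's `chartTopBox_subset_wboxPrint`. [cite: Balaban1985Variational, (144) p.300; Balaban1985RegularSpaces, p.98] -/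
theorem Icc_chartBox_subset_Icc_printWindow {d : ℕ} (L : ℕ) (c : Fin d → ℤ) (S : ℕ) {ρ : ℕ} (hρ : 1 ≤ ρ) (k : ℕ) :
    Set.Icc (sqLo L c ρ k k - 1) (sqHi L c S ρ k k + 1) ⊆ Set.Icc (tLo c ρ) (tHi c S ρ) := by
  have hsq : sqLo L c ρ k k = fun i => c i - ρ := by
    funext i; simp [sqLo, B8Eq131Cubes.bLo, B8Eq131Cubes.gs_zero]
  have hsq' : sqHi L c S ρ k k = fun i => c i + S - 1 + ρ := by
    funext i; simp [sqHi, B8Eq131Cubes.bHi, B8Eq131Cubes.gs_zero]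
  refine Set.Icc_subset_Icc (fun i => ?_) (fun i => ?_)
  · simp only [tLo, hsq, Pi.sub_apply, Pi.one_apply]; omega
  · simp only [tHi, hsq', Pi.add_apply, Pi.one_apply]; omega

end Rooted

/-! ## §2  MODULE 61 re-keyed: (154)₁ on EVERY constraint bond of `D″` under `NrmOfRecordWide` -/

section Record

variable {F : T4Family} {N : ℕ} [NeZero N]

/-- ★★★ **(154)₁ ON THE CHART's WHOLE INDEX SET, WIDE WINDOW**: if S3's gauge `u` carries `NrmOfRecordWide` at the datum `(j, idx)` and print's local family `D″` is (2.2)-admissible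
(`Adm22 D″ R M_b`, `2L ≤ R·M_b + 1`), then for the witness `w` and `h` the coarse axial gauge of the level-`j` data on `□̃` rooted at `ctr`, `𝒜_{j(c)}(U^u)(c) = M^{j(c)}((U^w)^{h̄})(c)`
for EVERY `c : BondIdx D″` (MODULE 61 §3 supplies `R̄g = 1` at both ends, MODULE 60 the identity).
[cite: Balaban1985Variational, (147) p.301, (150)–(154) pp.301–302; Balaban1985Averaging, (80) p.30, (88) p.31; Balaban1984PropagatorsII, (2.1)–(2.3) p.224] -/
theorem NrmOfRecordWide.exists_rep_bondIdx {Mc ρ : ℕ} {ν : Stage7Numerics} {M : ℕ} {g : ℕ → ℝ} {K k : ℕ} {s : SeqOfRecord F ν M g K k}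
    {U : GaugeField (F.P K) 0 (SU N)} {j : ℕ} {idx : Pt (F.P K).d} {u : GaugeTransf (F.P K) 0 (SU N)} {A : PBond (F.P K) 0 → MatA N}
    (hN : NrmOfRecordWide F N Mc ρ ν M g K k s U j idx u A) (hk : j ≤ (F.P K).m + (F.P K).K) {R Mb : ℕ}
    (hAdm : Adm22 (domainsMeet (cubeDomains (F.P K) (cornerP (F.P K) Mc ρ idx) (sideP (F.P K) Mc ρ) ρ j hk) (domainsOfSeq s.Ω j hk)) R Mb)
    (hRM : 2 * (F.P K).L ≤ R * Mb + 1) :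
    ∃ w : GaugeTransf (F.P K) 0 (SU N), IsResidual j w ∧
      (∀ i < j, AxialGauge (radialContourData (F.P K) i (SU N)) (Averaging.iter (avOfRecord F N K) i (gaugeAct w U))) ∧
      ∀ c : BondIdx (domainsMeet (cubeDomains (F.P K) (cornerP (F.P K) Mc ρ idx) (sideP (F.P K) Mc ρ) ρ j hk) (domainsOfSeq s.Ω j hk)),
        shearedAvgIter (avOfRecord F N K) (fun i => radialContourData (F.P K) i (SU N)) (loopAvgBlockOp expMeanLogSU) (gaugeAct u U) (c.1.1 : ℕ) c.1.2 =
          Averaging.iter (avOfRecord F N K) (c.1.1 : ℕ)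
            (gaugeAct (blockLift j (axialGaugeAt (Averaging.iter (avOfRecord F N K) j (gaugeAct w U))
              (tLo (cornerP (F.P K) Mc ρ idx) ρ) (tHi (cornerP (F.P K) Mc ρ idx) (sideP (F.P K) Mc ρ) ρ) (ctr (cornerP (F.P K) Mc ρ idx) (sideP (F.P K) Mc ρ))))
              (gaugeAct w U)) c.1.2 := by
  obtain ⟨w, hres, hax, hnorm⟩ := hN
  set D'' := domainsMeet (cubeDomains (F.P K) (cornerP (F.P K) Mc ρ idx) (sideP (F.P K) Mc ρ) ρ j hk) (domainsOfSeq s.Ω j hk) with hD''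
  have hDk : D''.k ≤ j := by
    show min j j ≤ j
    exact min_le_left _ _
  refine ⟨w, hres, hax, fun c => ?_⟩
  have hends := gaugeAvgIter_bondIdx_ends_eq_one expMeanLogSU D'' (expMeanLogSU_E_one' N) hAdm hRM _
    (fun j' hj' y hy => hnorm hk j' (hj'.trans hDk) y hy) c
  have hcj : (c.1.1 : ℕ) ≤ j := (D''.le_of_lamBond c.2).trans hDk
  exact shearedAvgIter_landau_eq_iter_rep F N K hk hax _ u hcj hends.1 hends.2

/-! ## §3  MODULE 62 re-keyed: the top rows with the centred radius -/

/-- ★ **THE TOP IDENTITY ON EVERY TOP CONSTRAINT BOND, WIDE WINDOW**: under `NrmOfRecordWide` and the (2.2) collar of `D″`, for every `c : PBond (F.P K) j` with `D″.LamBond j c`: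
`𝒜_j(U^u)(c) = (V^h)(c)`, `V = M^j U`, `h = axialGaugeAt V tLo tHi ctr` — §2 at the index bond `⟨⟨j, c⟩, ·⟩`, `M^j((U^w)^{h̄}) = (M^j(U^w))^h` (`iter_gaugeAct_blockLift`), `M^j(U^w) = M^j U`.
[cite: Balaban1985Variational, (147) p.301, (154) p.302; Balaban1985Averaging, (88) p.31] -/
theorem NrmOfRecordWide.shearedAvgIter_top_eq_dataAxial_of_lamBond {Mc ρ : ℕ} {ν : Stage7Numerics} {M : ℕ} {g : ℕ → ℝ} {K k : ℕ} {s : SeqOfRecord F ν M g K k}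
    {U : GaugeField (F.P K) 0 (SU N)} {j : ℕ} {idx : Pt (F.P K).d} {u : GaugeTransf (F.P K) 0 (SU N)} {A : PBond (F.P K) 0 → MatA N}
    (hN : NrmOfRecordWide F N Mc ρ ν M g K k s U j idx u A) (hk : j ≤ (F.P K).m + (F.P K).K) {R Mb : ℕ}
    (hAdm : Adm22 (domainsMeet (cubeDomains (F.P K) (cornerP (F.P K) Mc ρ idx) (sideP (F.P K) Mc ρ) ρ j hk) (domainsOfSeq s.Ω j hk)) R Mb)
    (hRM : 2 * (F.P K).L ≤ R * Mb + 1) (c : PBond (F.P K) j)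
    (hc : (domainsMeet (cubeDomains (F.P K) (cornerP (F.P K) Mc ρ idx) (sideP (F.P K) Mc ρ) ρ j hk) (domainsOfSeq s.Ω j hk)).LamBond j c) :
    shearedAvgIter (avOfRecord F N K) (fun i => radialContourData (F.P K) i (SU N)) (loopAvgBlockOp expMeanLogSU) (gaugeAct u U) j c =
      gaugeAct (axialGaugeAt (Averaging.iter (avOfRecord F N K) j U)
          (tLo (cornerP (F.P K) Mc ρ idx) ρ) (tHi (cornerP (F.P K) Mc ρ idx) (sideP (F.P K) Mc ρ) ρ) (ctr (cornerP (F.P K) Mc ρ idx) (sideP (F.P K) Mc ρ)))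
        (Averaging.iter (avOfRecord F N K) j U) c := by
  obtain ⟨w, hres, -, hall⟩ := NrmOfRecordWide.exists_rep_bondIdx hN hk hAdm hRM
  have hlt : j < (domainsMeet (cubeDomains (F.P K) (cornerP (F.P K) Mc ρ idx) (sideP (F.P K) Mc ρ) ρ j hk) (domainsOfSeq s.Ω j hk)).k + 1 := by
    show j < min j j + 1
    rw [min_self]; exact Nat.lt_succ_self j
  have hid := hall ⟨⟨⟨j, hlt⟩, c⟩, hc⟩
  have hV : Averaging.iter (avOfRecord F N K) j (gaugeAct w U) = Averaging.iter (avOfRecord F N K) j U :=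
    iter_gaugeAct_of_isResidual (avOfRecord F N K) hk hres U
  rw [hV] at hid
  rw [hid, iter_gaugeAct_blockLift (avOfRecord F N K) hk _ (gaugeAct w U), hV]

/-- ★★★ **THE TOP ROWS OF THE CHART's DATUM — print's (160), first case, WITH THE CENTRED RADIUS**: under `NrmOfRecordWide`, the (2.2) collar of `D″`, `1 ≤ ρ`, `L ≤ ρ`, and the displayed
`□̃`-box letter `δ̂ ≥ 0` («(7) for V»: the plaquettes of `M^j U` based in `[tLo, tHi]` are `< δ̂`; `tHi ≤ tLo + n`, `n + 1 < N_j`, `(d−1)·crad·δ̂ ≤ ½`), EVERY top constraint bond `c` of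
`D″` carries `‖log 𝒜_j(U^u)(c)‖ ≤ 2·((d−1)·crad·δ̂)`, `crad = ⌊sideP∕2⌋ + 2ρ` — the δ-LINEAR near row the budget charges to `C·δ` (`β₁ := 2(d−1)·crad·δ̂`; half of 62's width).
[cite: Balaban1985Variational, (160) p.303, (147) p.301, (144) p.300; Balaban1985Averaging, (21) p.21, (88) p.31; Balaban1985RegularSpaces, p.98, (1.129) p.98; Balaban1984PropagatorsII, (2.1)–(2.3) p.224] -/
theorem NrmOfRecordWide.norm_mlog_shearedAvgIter_top_le {Mc ρ : ℕ} {ν : Stage7Numerics} {M : ℕ} {g : ℕ → ℝ} {K k : ℕ} {s : SeqOfRecord F ν M g K k}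
    {U : GaugeField (F.P K) 0 (SU N)} {j : ℕ} {idx : Pt (F.P K).d} {u : GaugeTransf (F.P K) 0 (SU N)} {A : PBond (F.P K) 0 → MatA N}
    (hN : NrmOfRecordWide F N Mc ρ ν M g K k s U j idx u A) (hk : j ≤ (F.P K).m + (F.P K).K) (hj1 : 1 ≤ j) (hρ : 1 ≤ ρ) (hLρ : (F.P K).L ≤ ρ) {R Mb : ℕ}
    (hAdm : Adm22 (domainsMeet (cubeDomains (F.P K) (cornerP (F.P K) Mc ρ idx) (sideP (F.P K) Mc ρ) ρ j hk) (domainsOfSeq s.Ω j hk)) R Mb)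
    (hRM : 2 * (F.P K).L ≤ R * Mb + 1)
    {δ' : ℝ} (hδ : 0 ≤ δ')
    (hV : PlaqSmallOn (boxPlaqs (tLo (cornerP (F.P K) Mc ρ idx) ρ) (tHi (cornerP (F.P K) Mc ρ idx) (sideP (F.P K) Mc ρ) ρ)) δ'
      (Averaging.iter (avOfRecord F N K) j U))
    {n : ℕ} (hn : ∀ κ, (tHi (cornerP (F.P K) Mc ρ idx) (sideP (F.P K) Mc ρ) ρ) κ ≤ (tLo (cornerP (F.P K) Mc ρ idx) ρ) κ + n)
    (hnN : n + 1 < (F.P K).sitesPerDir j) (hr : (((F.P K).d - 1 : ℕ) : ℝ) * (crad (sideP (F.P K) Mc ρ) ρ) * δ' ≤ 1 / 2) (c : PBond (F.P K) j)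
    (hc : (domainsMeet (cubeDomains (F.P K) (cornerP (F.P K) Mc ρ idx) (sideP (F.P K) Mc ρ) ρ j hk) (domainsOfSeq s.Ω j hk)).LamBond j c) :
    ‖mlog ((shearedAvgIter (avOfRecord F N K) (fun i => radialContourData (F.P K) i (SU N)) (loopAvgBlockOp expMeanLogSU) (gaugeAct u U) j c : SU N) : MatA N)‖ ≤
      2 * ((((F.P K).d - 1 : ℕ) : ℝ) * (crad (sideP (F.P K) Mc ρ) ρ) * δ') := by
  rw [NrmOfRecordWide.shearedAvgIter_top_eq_dataAxial_of_lamBond hN hk hAdm hRM c hc]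
  -- the canonical chart boxes of the datum's cube tower (MODULE 59's four equation binders)
  set D'' := domainsMeet (cubeDomains (F.P K) (cornerP (F.P K) Mc ρ idx) (sideP (F.P K) Mc ρ) ρ j hk) (domainsOfSeq s.Ω j hk) with hD''
  set lo : ℕ → Pt (F.P K).d := fun j' => if j' = 0 then (fun i => ((F.P K).L : ℤ) * (sqLo (F.P K).L (cornerP (F.P K) Mc ρ idx) ρ j 1 i - 1))
    else sqLo (F.P K).L (cornerP (F.P K) Mc ρ idx) ρ j j' - 1 with hlo
  set hi : ℕ → Pt (F.P K).d := fun j' => if j' = 0 then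
      (fun i => ((F.P K).L : ℤ) * (sqHi (F.P K).L (cornerP (F.P K) Mc ρ idx) (sideP (F.P K) Mc ρ) ρ j 1 i + 1) + (((F.P K).L : ℤ) - 1))
    else sqHi (F.P K).L (cornerP (F.P K) Mc ρ idx) (sideP (F.P K) Mc ρ) ρ j j' + 1 with hhi
  have hlo0 : lo 0 = fun i => ((F.P K).L : ℤ) * (sqLo (F.P K).L (cornerP (F.P K) Mc ρ idx) ρ j 1 i - 1) := by simp [hlo]
  have hhi0 : hi 0 = fun i => ((F.P K).L : ℤ) * (sqHi (F.P K).L (cornerP (F.P K) Mc ρ idx) (sideP (F.P K) Mc ρ) ρ j 1 i + 1) + (((F.P K).L : ℤ) - 1) := by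
    simp [hhi]
  have hloj : ∀ j', 1 ≤ j' → lo j' = sqLo (F.P K).L (cornerP (F.P K) Mc ρ idx) ρ j j' - 1 := fun j' hj' => by
    simp [hlo, Nat.one_le_iff_ne_zero.mp hj']
  have hhij : ∀ j', 1 ≤ j' → hi j' = sqHi (F.P K).L (cornerP (F.P K) Mc ρ idx) (sideP (F.P K) Mc ρ) ρ j j' + 1 := fun j' hj' => by
    simp [hhi, Nat.one_le_iff_ne_zero.mp hj']
  -- `Ω″ ⊆ □` levelwise (the meet is finer than the cube tower), hence the boxed ends (dag-n07-w4)
  have hsub : ∀ j', 1 ≤ j' → D''.Om j' ⊆ (cubeDomains (F.P K) (cornerP (F.P K) Mc ρ idx) (sideP (F.P K) Mc ρ) ρ j hk).Om j' :=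
    fun j' _ => domainsMeet_le_left _ _ j'
  obtain ⟨hO, hS, -⟩ := levelBoxes_of_Om_subset_cubeDomains (P := F.P K) hLρ D'' hsub hlo0 hhi0 hloj hhij
  have hlt : j < D''.k + 1 := by
    show j < min j j + 1
    rw [min_self]; exact Nat.lt_succ_self j
  -- both ends of `c` lie in the level-`j` chart box `[lo j, hi j]`
  have hend : ∀ y : Site (F.P K) j, (y = c.src ∨ y = c.tgt) → y ∈ (castSite '' Set.Icc (lo j) (hi j) : Set (Site (F.P K) j)) := by
    intro y hy
    by_cases hmem : y ∈ D''.Om j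
    · have hnd : ¬ D''.Deep j y := by
        rcases hy with rfl | rfl
        · exact hc.2.1
        · exact hc.2.2
      exact hS j hj1 y ⟨hmem, hnd⟩
    · have hOc := hO ⟨⟨⟨j, hlt⟩, c⟩, hc⟩
      rcases hy with rfl | rfl
      · exact hOc.1 hmem
      · exact hOc.2 hmem
  have hs := hend _ (Or.inl rfl)
  have ht := hend _ (Or.inr rfl)
  rw [hloj j hj1, hhij j hj1] at hs ht
  -- the chart box `[sqLo_j − 1, sqHi_j + 1]` lies inside `□̃` (`1 ≤ ρ`, §1)
  have hIcc := Icc_chartBox_subset_Icc_printWindow (F.P K).L (cornerP (F.P K) Mc ρ idx) (sideP (F.P K) Mc ρ) hρ j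
  have hs' := Set.image_mono (f := (castSite : Pt (F.P K).d → Site (F.P K) j)) hIcc hs
  have ht' := Set.image_mono (f := (castSite : Pt (F.P K).d → Site (F.P K) j)) hIcc ht
  -- a non-wrapping box: two boxed ends make a box bond (dag-n07-w6)
  have hNwrap : ∀ κ, (tHi (cornerP (F.P K) Mc ρ idx) (sideP (F.P K) Mc ρ) ρ) κ + 1 - (tLo (cornerP (F.P K) Mc ρ idx) ρ) κ < (F.P K).sitesPerDir j :=
    fun κ => by have := hn κ; omega
  have hb := mem_boxBonds_of_ends_mem_box (P := F.P K) hNwrap hs' ht'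
  have hNwrap' : ∀ κ, (tHi (cornerP (F.P K) Mc ρ idx) (sideP (F.P K) Mc ρ) ρ) κ - (tLo (cornerP (F.P K) Mc ρ idx) ρ) κ < (F.P K).sitesPerDir j :=
    fun κ => by have := hn κ; omega
  -- the centre of `□̃` lies in `□̃`, at sup-distance `≤ crad` from every box point
  have hS1 : 1 ≤ sideP (F.P K) Mc ρ := by
    have := le_sideP (P := F.P K) Mc (lt_of_lt_of_le Nat.zero_lt_one hρ); omega
  obtain ⟨hr1, hr2, -⟩ := ctr_mem (a := cornerP (F.P K) Mc ρ idx) (ρ := ρ) hS1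
  have hd := dist1_gaugeAct_axialGaugeAt_le_of_mem_boxBonds (Averaging.iter (avOfRecord F N K) j U) subset_rfl hV hδ hNwrap' hr1 hr2
    (fun x hx hx' κ => abs_sub_ctr_le_crad hS1 x hx hx' κ) hb
  have hd' : dist1 (gaugeAct (axialGaugeAt (Averaging.iter (avOfRecord F N K) j U)
      (tLo (cornerP (F.P K) Mc ρ idx) ρ) (tHi (cornerP (F.P K) Mc ρ idx) (sideP (F.P K) Mc ρ) ρ) (ctr (cornerP (F.P K) Mc ρ idx) (sideP (F.P K) Mc ρ)))
      (Averaging.iter (avOfRecord F N K) j U) c) ≤ 1 / 2 := by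
    exact hd.trans hr
  calc ‖mlog ((gaugeAct (axialGaugeAt (Averaging.iter (avOfRecord F N K) j U)
          (tLo (cornerP (F.P K) Mc ρ idx) ρ) (tHi (cornerP (F.P K) Mc ρ idx) (sideP (F.P K) Mc ρ) ρ) (ctr (cornerP (F.P K) Mc ρ idx) (sideP (F.P K) Mc ρ)))
          (Averaging.iter (avOfRecord F N K) j U) c : SU N) : MatA N)‖
        ≤ 2 * dist1 (gaugeAct (axialGaugeAt (Averaging.iter (avOfRecord F N K) j U)
          (tLo (cornerP (F.P K) Mc ρ idx) ρ) (tHi (cornerP (F.P K) Mc ρ idx) (sideP (F.P K) Mc ρ) ρ) (ctr (cornerP (F.P K) Mc ρ idx) (sideP (F.P K) Mc ρ)))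
          (Averaging.iter (avOfRecord F N K) j U) c) := norm_mlog_le_two_mul hd'
    _ ≤ 2 * ((((F.P K).d - 1 : ℕ) : ℝ) * (crad (sideP (F.P K) Mc ρ) ρ) * δ') := by
        exact mul_le_mul_of_nonneg_left hd (by norm_num)

end Record

end Summit.QuantumFields.YangMills.BalabanUVNodes.N07NormalisationWideRows

end
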